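import Summits.ValiantsHypothesis.ValiantsHypothesis.Theorems.LacunarySymmetroidMatrixDescartesCensusDoorA34ConfluentNineKernel
import Summits.ValiantsHypothesis.ValiantsHypothesis.Theorems.LacunarySymmetroidMatrixDescartesCensusDoorA34NoNinefold

/-!
# `MatrixDescartes` census — DOOR A at `(3,4)`: THE CONFLUENT NINE, part 2 — the universal SLOPE FORMULA of a ninefold root of a `(3,3)` row with identity bottom letter (ALL supports),
# and the chamber law «in chambers II and IV the coalesced nine is a PSEUDOLINE (middle-branch) contact» (ALL supports)

HONEST FRAMING.  Object-search cell `pub-symmetroid`, door-A seat `val-sym-door-p3` (g25); helper file beside the OPEN typed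
statement `DoorA34 = PosRootLawAt 3 4 18` (route item `Theses.LacunarySymmetroid.DoorA34`, stmt-ValiantsHypothesis-19980),
asserted nowhere here.  The cell's one mechanism of record with ceiling `19` at `(3,4)` is the flag ladder over a `(3,3)` SOURCE
row `S₀ + X^{d₁}S₁ + X^{d₂}S₂` with nine positive det-roots and a DEFINITE bottom letter, all nine of PSD type (Claim L, kernel
`Census.FlagInertia`, `Census.flagLaw_no_five_one`); located capacity `7`, located law «capacity = maximal realisable contact
order + 1» (DOOR-A34-ENG2G3 §3, exact contact-order table in 41 chambers, kernel instance `NoNinefold.not_ninefold_root` on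
`(0,1,4)`).  This file types the TOP of the contact-order stratification for EVERY support at once:

* (part 1, `…ConfluentNineKernel`: the confluent Vandermonde kernel `two_point_relation'` of a fewnomial with a maximal-order
  root and the ten-term expansion `det_pencil_eq_sum_ten` of the pencil.)
* §3 **`confluent_slope_formula`** (ALL supports off the three walls `d₂ = 2d₁, 3d₁, 3d₁/2`): if `(X − 1)⁹ ∣ det F` then, with
  `M = S₁ + S₂ = F(1) − 1`, the slope at the root `t = 1` of `g(t) = det(t·1 + M)` is the universal rational function
  `g′(1) = 3 + 2 tr M + e₂(M) = 4200 d₁²d₂²(d₁² − d₁d₂ + d₂²) / ((d₂−2d₁)(d₂−3d₁)(2d₂−d₁)(2d₂−3d₁)(3d₂−d₁)(3d₂−2d₁))`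
  (five two-point relations + one polynomial elimination certificate checked by `ring`).
* §4 **`ninefold_root_indefinite_one`** / §5 **`ninefold_root_indefinite`**, **`not_posSemidef_of_ninefold_root`**: in
  chamber IV (`d₁ < d₂ < 3d₁/2`) and chamber II (`2d₁ < d₂ < 3d₁`) that slope is NEGATIVE, so `g = (t−1)·Q` with `Q(1) < 0`,
  `M` has eigenvalues on both sides of `−1`, and the quadratic form of `F(x₀)` takes BOTH signs at ANY ninefold root `x₀`
  (scaling `X ↦ x₀X`, `det_pencil_comp_scale`): THE TOTALLY COALESCED NINE IS A MIDDLE-BRANCH (pseudoline) CONTACT, never a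
  coalescence of PSD-singular points — for every support of those chambers and ANY real letters (no symmetry needed).
  In chambers I/III the slope is positive (end contact); there the obstruction is non-hyperbolicity (eng-2's exact table),
  not typed here.

Nothing here bounds `ζ_sym(3,3)` or `ζ_sym(3,4)`: a statement about the multiplicity-nine stratum only («no 8/9-fold contact
does not by itself bound the count»).  `DoorA34`, Claim L on `d₂ < 2d₁` and `MatrixDescartes` (stmt-ValiantsHypothesis-18050)
stay OPEN; registers unchanged; nothing on `VP ≠ VNP`.
[folklore] Euler operator / divided differences (confluent Vandermonde), Leibniz expansion of a `3 × 3` determinant, Vieta,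
the intermediate value theorem; certificates by `ring` / `linarith` / `simp`.
-/

-- `Summit.ValiantsHypothesis.ValiantsHypothesis.…` repeats a component by the D-0017 layout
-- (single-conjunct summit), which the `dupNamespace` linter flags; the name is mandated.
set_option linter.dupNamespace false

namespace Summit.ValiantsHypothesis.ValiantsHypothesis.Theorems.LacunarySymmetroidMatrixDescartes.Census.ConfluentNine

open Polynomial Finset
open scoped BigOperators

/-! ## 3. The confluent slope formula -/

/-- **THE CONFLUENT SLOPE FORMULA (all supports).**  Let `F = 1 + X^{d₁}S₁ + X^{d₂}S₂` be a real `3 × 3` three-letter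
pencil with identity bottom letter on a support `(0, d₁, d₂)` off the three walls `d₂ = 2d₁`, `d₂ = 3d₁`, `2d₂ = 3d₁`
(so the ten triple sums are distinct), and suppose `det F` has a NINEFOLD root at `x₀ = 1` (total coalescence of the
Descartes-maximal nine positive roots).  Then, with `M = S₁ + S₂ = F(1) − 1` and `g(t) = det(t·1 + M) = t³ + tr M·t² + e₂(M)·t + det M`
(so `g(1) = det F(1) = 0`), the slope `g′(1) = 3 + 2·tr M + e₂(M)` is the universal rational function
`4200·d₁²d₂²(d₁² − d₁d₂ + d₂²) / ((d₂−2d₁)(d₂−3d₁)(2d₂−d₁)(2d₂−3d₁)(3d₂−d₁)(3d₂−2d₁))` of the support alone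
(confluent Vandermonde kernel `c_e ∝ 1/∏(e − e′)` via `two_point_relation`, then elimination). [folklore] -/
theorem confluent_slope_formula (d₁ d₂ : ℕ) (S₁ S₂ : Matrix (Fin 3) (Fin 3) ℝ) (h0 : 0 < d₁) (h01 : d₁ < d₂)
    (hw2 : d₂ ≠ 2 * d₁) (hw3 : d₂ ≠ 3 * d₁) (hw32 : 2 * d₂ ≠ 3 * d₁)
    (h9 : (X - C 1) ^ 9 ∣
      (∑ l, (X : ℝ[X]) ^ (![0, d₁, d₂] : Fin 3 → ℕ) l • ((![1, S₁, S₂] : Fin 3 → Matrix (Fin 3) (Fin 3) ℝ) l).map C).det) :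
    3 + 2 * (S₁ + S₂).trace
        + ((S₁ + S₂) 0 0 * (S₁ + S₂) 1 1 - (S₁ + S₂) 0 1 * (S₁ + S₂) 1 0
            + ((S₁ + S₂) 0 0 * (S₁ + S₂) 2 2 - (S₁ + S₂) 0 2 * (S₁ + S₂) 2 0)
            + ((S₁ + S₂) 1 1 * (S₁ + S₂) 2 2 - (S₁ + S₂) 1 2 * (S₁ + S₂) 2 1))
      = 4200 * (d₁ : ℝ) ^ 2 * (d₂ : ℝ) ^ 2 * ((d₁ : ℝ) ^ 2 - d₁ * d₂ + (d₂ : ℝ) ^ 2)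
          / (((d₂ : ℝ) - 2 * d₁) * ((d₂ : ℝ) - 3 * d₁) * (2 * (d₂ : ℝ) - d₁) * (2 * (d₂ : ℝ) - 3 * d₁)
              * (3 * (d₂ : ℝ) - d₁) * (3 * (d₂ : ℝ) - 2 * d₁)) := by
  rw [det_pencil_eq_sum_ten] at h9
  have hcard : (Finset.univ : Finset (Fin 10)).card ≤ 9 + 1 := by rw [Finset.card_univ, Fintype.card_fin]
  -- real-number bookkeeping of the support
  have ha : (0 : ℝ) < d₁ := by exact_mod_cast h0
  have hab : (d₁ : ℝ) < d₂ := by exact_mod_cast h01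
  have hw2' : (d₂ : ℝ) ≠ 2 * d₁ := by exact_mod_cast hw2
  have hw3' : (d₂ : ℝ) ≠ 3 * d₁ := by exact_mod_cast hw3
  have hw32' : 2 * (d₂ : ℝ) ≠ 3 * d₁ := by exact_mod_cast hw32
  have n_a : (d₁ : ℝ) ≠ 0 := ha.ne'
  have n_b : (d₂ : ℝ) ≠ 0 := (ha.trans hab).ne'
  have n_apb : (d₁ : ℝ) + d₂ ≠ 0 := by linarith
  have n_amb : (d₁ : ℝ) - d₂ ≠ 0 := by intro h; linarith
  have n_bma : (d₂ : ℝ) - d₁ ≠ 0 := by intro h; linarith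
  have n_am2b : (d₁ : ℝ) - 2 * d₂ ≠ 0 := by intro h; linarith
  have n_am3b : (d₁ : ℝ) - 3 * d₂ ≠ 0 := by intro h; linarith
  have n_2am3b : 2 * (d₁ : ℝ) - 3 * d₂ ≠ 0 := by intro h; linarith
  have n_2amb : 2 * (d₁ : ℝ) - d₂ ≠ 0 := by intro h; apply hw2'; linarith
  have n_bm2a : (d₂ : ℝ) - 2 * d₁ ≠ 0 := by intro h; apply hw2'; linarith
  have n_bm3a : (d₂ : ℝ) - 3 * d₁ ≠ 0 := by intro h; apply hw3'; linarith
  have n_2bma : 2 * (d₂ : ℝ) - d₁ ≠ 0 := by intro h; linarith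
  have n_2bm3a : 2 * (d₂ : ℝ) - 3 * d₁ ≠ 0 := by intro h; apply hw32'; linarith
  have n_2am3b' : 2 * (d₁ : ℝ) - 3 * d₂ ≠ 0 := n_2am3b
  have n_3bma : 3 * (d₂ : ℝ) - d₁ ≠ 0 := by intro h; linarith
  have n_3bm2a : 3 * (d₂ : ℝ) - 2 * d₁ ≠ 0 := by intro h; linarith
  -- the five confluence relations (coefficient of X^{d₁}, X^{d₂}, X^{2d₁}, X^{d₁+d₂}, X^{2d₂} against the constant 1)
  have R1 : 36 * (d₁ : ℝ) ^ 2 * (d₂ : ℝ) ^ 3 * ((d₁ : ℝ) + d₂) * (2 * (d₁ : ℝ) + d₂) * ((d₁ : ℝ) + 2 * d₂)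
      + S₁.trace * (-4 * (d₁ : ℝ) ^ 2 * (d₂ : ℝ) ^ 2 * ((d₁ : ℝ) + d₂) * ((d₁ : ℝ) - d₂) * ((d₁ : ℝ) - 2 * d₂)
          * ((d₁ : ℝ) - 3 * d₂)) = 0 := by
    have h := two_point_relation' (Finset.univ : Finset (Fin 10)) _ _ h9 hcard (i₀ := 0) (i := 1)
      (Finset.mem_univ _) (Finset.mem_univ _) (by decide)
    convert h using 2 <;> simp [Fin.prod_univ_succ] <;> ring
  have R2 : 36 * (d₁ : ℝ) ^ 3 * (d₂ : ℝ) ^ 2 * ((d₁ : ℝ) + d₂) * (2 * (d₁ : ℝ) + d₂) * ((d₁ : ℝ) + 2 * d₂)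
      + S₂.trace * (-4 * (d₁ : ℝ) ^ 2 * (d₂ : ℝ) ^ 2 * ((d₁ : ℝ) + d₂) * ((d₂ : ℝ) - d₁) * ((d₂ : ℝ) - 2 * d₁)
          * ((d₂ : ℝ) - 3 * d₁)) = 0 := by
    have h := two_point_relation' (Finset.univ : Finset (Fin 10)) _ _ h9 hcard (i₀ := 0) (i := 2)
      (Finset.mem_univ _) (Finset.mem_univ _) (by decide)
    convert h using 2 <;> simp [Fin.prod_univ_succ] <;> ring
  have R3 : 18 * (d₁ : ℝ) ^ 2 * (d₂ : ℝ) ^ 3 * ((d₁ : ℝ) + d₂) * (2 * (d₁ : ℝ) + d₂) * ((d₁ : ℝ) + 2 * d₂)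
      + (S₁ 0 0 * S₁ 1 1 - S₁ 0 1 * S₁ 1 0 + (S₁ 0 0 * S₁ 2 2 - S₁ 0 2 * S₁ 2 0) + (S₁ 1 1 * S₁ 2 2 - S₁ 1 2 * S₁ 2 1))
        * (2 * (d₁ : ℝ) ^ 2 * (d₂ : ℝ) * (2 * (d₁ : ℝ) - d₂) * ((d₁ : ℝ) - d₂) ^ 2 * ((d₁ : ℝ) - 2 * d₂)
          * (2 * (d₁ : ℝ) - 3 * d₂)) = 0 := by
    have h := two_point_relation' (Finset.univ : Finset (Fin 10)) _ _ h9 hcard (i₀ := 0) (i := 3)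
      (Finset.mem_univ _) (Finset.mem_univ _) (by decide)
    convert h using 2 <;> simp [Fin.prod_univ_succ] <;> ring
  have R4 : 36 * (d₁ : ℝ) ^ 3 * (d₂ : ℝ) ^ 3 * (2 * (d₁ : ℝ) + d₂) * ((d₁ : ℝ) + 2 * d₂)
      + (S₁ 0 0 * S₂ 1 1 + S₂ 0 0 * S₁ 1 1 - S₁ 0 1 * S₂ 1 0 - S₂ 0 1 * S₁ 1 0
          + (S₁ 0 0 * S₂ 2 2 + S₂ 0 0 * S₁ 2 2 - S₁ 0 2 * S₂ 2 0 - S₂ 0 2 * S₁ 2 0)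
          + (S₁ 1 1 * S₂ 2 2 + S₂ 1 1 * S₁ 2 2 - S₁ 1 2 * S₂ 2 1 - S₂ 1 2 * S₁ 2 1))
        * (-((d₁ : ℝ) ^ 2) * (d₂ : ℝ) ^ 2 * ((d₁ : ℝ) - d₂) ^ 2 * ((d₂ : ℝ) - 2 * d₁) * ((d₁ : ℝ) - 2 * d₂)) = 0 := by
    have h := two_point_relation' (Finset.univ : Finset (Fin 10)) _ _ h9 hcard (i₀ := 0) (i := 4)
      (Finset.mem_univ _) (Finset.mem_univ _) (by decide)
    convert h using 2 <;> simp [Fin.prod_univ_succ] <;> ring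
  have R5 : 18 * (d₁ : ℝ) ^ 3 * (d₂ : ℝ) ^ 2 * ((d₁ : ℝ) + d₂) * (2 * (d₁ : ℝ) + d₂) * ((d₁ : ℝ) + 2 * d₂)
      + (S₂ 0 0 * S₂ 1 1 - S₂ 0 1 * S₂ 1 0 + (S₂ 0 0 * S₂ 2 2 - S₂ 0 2 * S₂ 2 0) + (S₂ 1 1 * S₂ 2 2 - S₂ 1 2 * S₂ 2 1))
        * (2 * (d₁ : ℝ) * (d₂ : ℝ) ^ 2 * (2 * (d₂ : ℝ) - d₁) * ((d₂ : ℝ) - d₁) ^ 2 * (2 * (d₂ : ℝ) - 3 * d₁)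
          * ((d₂ : ℝ) - 2 * d₁)) = 0 := by
    have h := two_point_relation' (Finset.univ : Finset (Fin 10)) _ _ h9 hcard (i₀ := 0) (i := 5)
      (Finset.mem_univ _) (Finset.mem_univ _) (by decide)
    convert h using 2 <;> simp [Fin.prod_univ_succ] <;> ring
  -- elimination
  have hD : ((d₂ : ℝ) - 2 * d₁) * ((d₂ : ℝ) - 3 * d₁) * (2 * (d₂ : ℝ) - d₁) * (2 * (d₂ : ℝ) - 3 * d₁)
      * (3 * (d₂ : ℝ) - d₁) * (3 * (d₂ : ℝ) - 2 * d₁) ≠ 0 := by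
    apply_rules [mul_ne_zero]
  have h4 : (-4 : ℝ) ≠ 0 := by norm_num
  have h2 : (2 : ℝ) ≠ 0 := by norm_num
  have hB1 : -4 * (d₁ : ℝ) ^ 2 * (d₂ : ℝ) ^ 2 * ((d₁ : ℝ) + d₂) * ((d₁ : ℝ) - d₂) * ((d₁ : ℝ) - 2 * d₂)
      * ((d₁ : ℝ) - 3 * d₂) ≠ 0 :=
    mul_ne_zero (mul_ne_zero (mul_ne_zero (mul_ne_zero (mul_ne_zero (mul_ne_zero h4 (pow_ne_zero _ n_a))
      (pow_ne_zero _ n_b)) n_apb) n_amb) n_am2b) n_am3b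
  have hB2 : -4 * (d₁ : ℝ) ^ 2 * (d₂ : ℝ) ^ 2 * ((d₁ : ℝ) + d₂) * ((d₂ : ℝ) - d₁) * ((d₂ : ℝ) - 2 * d₁)
      * ((d₂ : ℝ) - 3 * d₁) ≠ 0 :=
    mul_ne_zero (mul_ne_zero (mul_ne_zero (mul_ne_zero (mul_ne_zero (mul_ne_zero h4 (pow_ne_zero _ n_a))
      (pow_ne_zero _ n_b)) n_apb) n_bma) n_bm2a) n_bm3a
  have hB3 : 2 * (d₁ : ℝ) ^ 2 * (d₂ : ℝ) * (2 * (d₁ : ℝ) - d₂) * ((d₁ : ℝ) - d₂) ^ 2 * ((d₁ : ℝ) - 2 * d₂)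
      * (2 * (d₁ : ℝ) - 3 * d₂) ≠ 0 :=
    mul_ne_zero (mul_ne_zero (mul_ne_zero (mul_ne_zero (mul_ne_zero (mul_ne_zero h2 (pow_ne_zero _ n_a))
      n_b) n_2amb) (pow_ne_zero _ n_amb)) n_am2b) n_2am3b
  have hB4 : -((d₁ : ℝ) ^ 2) * (d₂ : ℝ) ^ 2 * ((d₁ : ℝ) - d₂) ^ 2 * ((d₂ : ℝ) - 2 * d₁) * ((d₁ : ℝ) - 2 * d₂) ≠ 0 :=
    mul_ne_zero (mul_ne_zero (mul_ne_zero (mul_ne_zero (neg_ne_zero.mpr (pow_ne_zero _ n_a)) (pow_ne_zero _ n_b))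
      (pow_ne_zero _ n_amb)) n_bm2a) n_am2b
  have hB5 : 2 * (d₁ : ℝ) * (d₂ : ℝ) ^ 2 * (2 * (d₂ : ℝ) - d₁) * ((d₂ : ℝ) - d₁) ^ 2 * (2 * (d₂ : ℝ) - 3 * d₁)
      * ((d₂ : ℝ) - 2 * d₁) ≠ 0 :=
    mul_ne_zero (mul_ne_zero (mul_ne_zero (mul_ne_zero (mul_ne_zero (mul_ne_zero h2 n_a)
      (pow_ne_zero _ n_b)) n_2bma) (pow_ne_zero _ n_bma)) n_2bm3a) n_bm2a
  have hB := mul_ne_zero (mul_ne_zero (mul_ne_zero (mul_ne_zero hB1 hB2) hB3) hB4) hB5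
  set D : ℝ := ((d₂ : ℝ) - 2 * d₁) * ((d₂ : ℝ) - 3 * d₁) * (2 * (d₂ : ℝ) - d₁) * (2 * (d₂ : ℝ) - 3 * d₁)
      * (3 * (d₂ : ℝ) - d₁) * (3 * (d₂ : ℝ) - 2 * d₁) with hD_def
  set B₁ : ℝ := -4 * (d₁ : ℝ) ^ 2 * (d₂ : ℝ) ^ 2 * ((d₁ : ℝ) + d₂) * ((d₁ : ℝ) - d₂) * ((d₁ : ℝ) - 2 * d₂)
      * ((d₁ : ℝ) - 3 * d₂) with hB1_def
  set B₂ : ℝ := -4 * (d₁ : ℝ) ^ 2 * (d₂ : ℝ) ^ 2 * ((d₁ : ℝ) + d₂) * ((d₂ : ℝ) - d₁) * ((d₂ : ℝ) - 2 * d₁)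
      * ((d₂ : ℝ) - 3 * d₁) with hB2_def
  set B₃ : ℝ := 2 * (d₁ : ℝ) ^ 2 * (d₂ : ℝ) * (2 * (d₁ : ℝ) - d₂) * ((d₁ : ℝ) - d₂) ^ 2 * ((d₁ : ℝ) - 2 * d₂)
      * (2 * (d₁ : ℝ) - 3 * d₂) with hB3_def
  set B₄ : ℝ := -((d₁ : ℝ) ^ 2) * (d₂ : ℝ) ^ 2 * ((d₁ : ℝ) - d₂) ^ 2 * ((d₂ : ℝ) - 2 * d₁) * ((d₁ : ℝ) - 2 * d₂)
    with hB4_def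
  set B₅ : ℝ := 2 * (d₁ : ℝ) * (d₂ : ℝ) ^ 2 * (2 * (d₂ : ℝ) - d₁) * ((d₂ : ℝ) - d₁) ^ 2 * (2 * (d₂ : ℝ) - 3 * d₁)
      * ((d₂ : ℝ) - 2 * d₁) with hB5_def
  have key : ((3 + 2 * (S₁ + S₂).trace
        + ((S₁ + S₂) 0 0 * (S₁ + S₂) 1 1 - (S₁ + S₂) 0 1 * (S₁ + S₂) 1 0
            + ((S₁ + S₂) 0 0 * (S₁ + S₂) 2 2 - (S₁ + S₂) 0 2 * (S₁ + S₂) 2 0)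
            + ((S₁ + S₂) 1 1 * (S₁ + S₂) 2 2 - (S₁ + S₂) 1 2 * (S₁ + S₂) 2 1))) * D
        - 4200 * (d₁ : ℝ) ^ 2 * (d₂ : ℝ) ^ 2 * ((d₁ : ℝ) ^ 2 - d₁ * d₂ + (d₂ : ℝ) ^ 2))
      * (B₁ * B₂ * B₃ * B₄ * B₅) = 0 := by
    linear_combination (norm := skip) (2 * D * B₂ * B₃ * B₄ * B₅) * R1 + (2 * D * B₁ * B₃ * B₄ * B₅) * R2
      + (D * B₁ * B₂ * B₄ * B₅) * R3 + (D * B₁ * B₂ * B₃ * B₅) * R4 + (D * B₁ * B₂ * B₃ * B₄) * R5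
    simp only [hD_def, hB1_def, hB2_def, hB3_def, hB4_def, hB5_def, Matrix.trace_add, Matrix.add_apply]
    ring1
  have key2 := (mul_eq_zero.mp key).resolve_right hB
  rw [eq_div_iff hD]
  linarith [key2]


/-! ## 4. Chambers II and IV: the confluent nine is a middle-branch (pseudoline) contact -/

/-- Sign of the universal slope in chambers II (`2d₁ < d₂ < 3d₁`) and IV (`d₁ < d₂ < 3d₁/2`): NEGATIVE. [folklore] -/
theorem slope_formula_neg (d₁ d₂ : ℕ) (h0 : 0 < d₁)
    (hch : (d₁ < d₂ ∧ 2 * d₂ < 3 * d₁) ∨ (2 * d₁ < d₂ ∧ d₂ < 3 * d₁)) :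
    4200 * (d₁ : ℝ) ^ 2 * (d₂ : ℝ) ^ 2 * ((d₁ : ℝ) ^ 2 - d₁ * d₂ + (d₂ : ℝ) ^ 2)
          / (((d₂ : ℝ) - 2 * d₁) * ((d₂ : ℝ) - 3 * d₁) * (2 * (d₂ : ℝ) - d₁) * (2 * (d₂ : ℝ) - 3 * d₁)
              * (3 * (d₂ : ℝ) - d₁) * (3 * (d₂ : ℝ) - 2 * d₁)) < 0 := by
  have ha : (0 : ℝ) < d₁ := by exact_mod_cast h0
  have h01 : d₁ < d₂ := by rcases hch with ⟨h, _⟩ | ⟨h, _⟩ <;> omega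
  have hab : (d₁ : ℝ) < d₂ := by exact_mod_cast h01
  have hb : (0 : ℝ) < d₂ := ha.trans hab
  have hN : 0 < 4200 * (d₁ : ℝ) ^ 2 * (d₂ : ℝ) ^ 2 * ((d₁ : ℝ) ^ 2 - d₁ * d₂ + (d₂ : ℝ) ^ 2) := by
    have : 0 < (d₁ : ℝ) ^ 2 - d₁ * d₂ + (d₂ : ℝ) ^ 2 := by nlinarith [sq_nonneg ((d₁ : ℝ) - d₂)]
    positivity
  apply div_neg_of_pos_of_neg hN
  have p3 : 0 < 2 * (d₂ : ℝ) - d₁ := by linarith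
  have p5 : 0 < 3 * (d₂ : ℝ) - d₁ := by linarith
  have p6 : 0 < 3 * (d₂ : ℝ) - 2 * d₁ := by linarith
  rcases hch with ⟨_, h2⟩ | ⟨h1, h2⟩
  · have h2' : 2 * (d₂ : ℝ) < 3 * d₁ := by exact_mod_cast h2
    have q1 : (d₂ : ℝ) - 2 * d₁ < 0 := by linarith
    have q2 : (d₂ : ℝ) - 3 * d₁ < 0 := by linarith
    have q4 : 2 * (d₂ : ℝ) - 3 * d₁ < 0 := by linarith
    have s12 : 0 < ((d₂ : ℝ) - 2 * d₁) * ((d₂ : ℝ) - 3 * d₁) := mul_pos_of_neg_of_neg q1 q2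
    have s123 := mul_pos s12 p3
    have s1234 := mul_neg_of_pos_of_neg s123 q4
    have s12345 := mul_neg_of_neg_of_pos s1234 p5
    exact mul_neg_of_neg_of_pos s12345 p6
  · have h1' : 2 * (d₁ : ℝ) < d₂ := by exact_mod_cast h1
    have h2' : (d₂ : ℝ) < 3 * d₁ := by exact_mod_cast h2
    have q1 : 0 < (d₂ : ℝ) - 2 * d₁ := by linarith
    have q2 : (d₂ : ℝ) - 3 * d₁ < 0 := by linarith
    have q4 : 0 < 2 * (d₂ : ℝ) - 3 * d₁ := by linarith
    have s12 : ((d₂ : ℝ) - 2 * d₁) * ((d₂ : ℝ) - 3 * d₁) < 0 := mul_neg_of_pos_of_neg q1 q2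
    have s123 := mul_neg_of_neg_of_pos s12 p3
    have s1234 := mul_neg_of_neg_of_pos s123 q4
    have s12345 := mul_neg_of_neg_of_pos s1234 p5
    exact mul_neg_of_neg_of_pos s12345 p6

/-- Off the walls in chambers II and IV the exponent hypotheses of `confluent_slope_formula` hold. [folklore] -/
theorem walls_of_chamber (d₁ d₂ : ℕ) (hch : (d₁ < d₂ ∧ 2 * d₂ < 3 * d₁) ∨ (2 * d₁ < d₂ ∧ d₂ < 3 * d₁)) :
    0 < d₁ ∧ d₁ < d₂ ∧ d₂ ≠ 2 * d₁ ∧ d₂ ≠ 3 * d₁ ∧ 2 * d₂ ≠ 3 * d₁ := by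
  omega

/-- A monic real quadratic that is negative at `1` has a root `> 1` and a root `< 1`. [folklore] -/
theorem quadratic_roots_around_one (α β : ℝ) (hneg : 1 + α + β < 0) :
    (∃ t : ℝ, 1 < t ∧ t ^ 2 + α * t + β = 0) ∧ (∃ t : ℝ, t < 1 ∧ t ^ 2 + α * t + β = 0) := by
  set T : ℝ := 2 + |α| + |β| with hT
  have hT1 : (1 : ℝ) ≤ T := by have := abs_nonneg α; have := abs_nonneg β; linarith
  have hcont : Continuous fun t : ℝ => t ^ 2 + α * t + β := by fun_prop
  have hQ1 : (1 : ℝ) ^ 2 + α * 1 + β < 0 := by linarith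
  have hQT : 0 ≤ T ^ 2 + α * T + β := by
    have h1 : -|α| * T ≤ α * T := by
      have := neg_abs_le α; nlinarith
    have h2 : -|β| ≤ β := neg_abs_le β
    nlinarith [abs_nonneg α, abs_nonneg β]
  have hQT' : 0 ≤ (-T) ^ 2 + α * (-T) + β := by
    have h1 : -|α| * T ≤ -(α * T) := by
      have := le_abs_self α; nlinarith
    have h2 : -|β| ≤ β := neg_abs_le β
    nlinarith [abs_nonneg α, abs_nonneg β]
  constructor
  · obtain ⟨t, ht, ht0⟩ := intermediate_value_Icc hT1 hcont.continuousOn ⟨hQ1.le, hQT⟩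
    refine ⟨t, ?_, ht0⟩
    rcases eq_or_lt_of_le ht.1 with h | h
    · rw [← h] at ht0; linarith
    · exact h
  · have hT1' : -T ≤ 1 := by linarith
    obtain ⟨t, ht, ht0⟩ := intermediate_value_Icc' hT1' hcont.continuousOn ⟨hQ1.le, hQT'⟩
    refine ⟨t, ?_, ht0⟩
    rcases eq_or_lt_of_le ht.2 with h | h
    · rw [h] at ht0; linarith
    · exact h

/-- From an eigenvalue `-t` of `M` (`det(t·1 + M) = 0`) to the value `(1 - t)·‖v‖²` of the quadratic form of `1 + M`
at the eigenvector. [folklore] -/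
theorem exists_quadForm_eq (M : Matrix (Fin 3) (Fin 3) ℝ) {t : ℝ} (ht : (t • (1 : Matrix (Fin 3) (Fin 3) ℝ) + M).det = 0) :
    ∃ v : Fin 3 → ℝ, v ≠ 0 ∧ v ⬝ᵥ ((1 + M).mulVec v) = (1 - t) * (v ⬝ᵥ v) := by
  obtain ⟨v, hv, hMv⟩ := Matrix.exists_mulVec_eq_zero_iff.mpr ht
  refine ⟨v, hv, ?_⟩
  have hMv' : M.mulVec v = -(t • v) := by
    rw [Matrix.add_mulVec, Matrix.smul_mulVec, Matrix.one_mulVec] at hMv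
    exact eq_neg_of_add_eq_zero_right hMv
  rw [Matrix.add_mulVec, Matrix.one_mulVec, hMv', dotProduct_add, dotProduct_neg, dotProduct_smul]
  simp only [smul_eq_mul]
  ring

/-- **THE CONFLUENT NINE IS A PSEUDOLINE CONTACT (chambers II and IV, all supports).**  Let `S₁, S₂` be ANY real `3 × 3`
letters and `(0, d₁, d₂)` a support in chamber IV (`d₁ < d₂ < 3d₁/2`) or chamber II (`2d₁ < d₂ < 3d₁`).  If the
determinant of the pencil `F = 1 + X^{d₁}S₁ + X^{d₂}S₂` has a NINEFOLD root at `x₀ = 1`, then the quadratic form of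
`F(1) = 1 + S₁ + S₂` takes BOTH signs: the coalesced nine roots sit on the MIDDLE eigenvalue branch, so `F(1)` is neither
positive nor negative semidefinite.  (By `confluent_slope_formula` + `slope_formula_neg`, `g(t) = det(t·1 + M) = (t−1)·Q(t)` with
`Q(1) = g′(1) < 0`, so `M = S₁ + S₂` has eigenvalues on both sides of `−1`.)  In particular a ninefold positive root of a
definite-bottom `(3,3)` row in these chambers is never a coalescence of PSD-singular points (cf. Claim L / the flag ladder,
and `NoNinefold.not_ninefold_root` for the support `(0,1,4)` with definite top). [folklore] -/
theorem ninefold_root_indefinite_one (d₁ d₂ : ℕ) (S₁ S₂ : Matrix (Fin 3) (Fin 3) ℝ)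
    (hch : (d₁ < d₂ ∧ 2 * d₂ < 3 * d₁) ∨ (2 * d₁ < d₂ ∧ d₂ < 3 * d₁))
    (h9 : (X - C 1) ^ 9 ∣
      (∑ l, (X : ℝ[X]) ^ (![0, d₁, d₂] : Fin 3 → ℕ) l • ((![1, S₁, S₂] : Fin 3 → Matrix (Fin 3) (Fin 3) ℝ) l).map C).det) :
    (∃ v : Fin 3 → ℝ, v ⬝ᵥ ((1 + S₁ + S₂).mulVec v) < 0) ∧ (∃ w : Fin 3 → ℝ, 0 < w ⬝ᵥ ((1 + S₁ + S₂).mulVec w)) := by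
  obtain ⟨h0, h01, hw2, hw3, hw32⟩ := walls_of_chamber d₁ d₂ hch
  -- `0 < v ⬝ᵥ v` for `v ≠ 0` (cf. `Literature.AlgebraicTopology.FundamentalGroup.GS3.dotProduct_self_pos'`)
  have hpos : ∀ v : Fin 3 → ℝ, v ≠ 0 → 0 < v ⬝ᵥ v := fun v hv => by
    rcases (dotProduct_self_star_nonneg v).lt_or_eq with h | h
    · simpa using h
    · exfalso; apply hv
      have : v ⬝ᵥ v = 0 := by simpa using h.symm
      exact dotProduct_self_eq_zero.mp this
  have hslope := confluent_slope_formula d₁ d₂ S₁ S₂ h0 h01 hw2 hw3 hw32 h9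
  have hneg := slope_formula_neg d₁ d₂ h0 hch
  rw [← hslope] at hneg
  set M : Matrix (Fin 3) (Fin 3) ℝ := S₁ + S₂ with hM
  -- g(1) = det F(1) = 0
  have hroot : (M + (1 : ℝ) • (1 : Matrix (Fin 3) (Fin 3) ℝ)).det = 0 := by
    have h1 : (X - C (1 : ℝ)) ∣
        (∑ l, (X : ℝ[X]) ^ (![0, d₁, d₂] : Fin 3 → ℕ) l • ((![1, S₁, S₂] : Fin 3 → Matrix (Fin 3) (Fin 3) ℝ) l).map C).det :=
      (dvd_pow_self _ (by norm_num)).trans h9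
    rw [dvd_iff_isRoot, IsRoot, SymmetroidDescartes.eval_det_pencil] at h1
    have e : (∑ l, (1 : ℝ) ^ (![0, d₁, d₂] : Fin 3 → ℕ) l • (![1, S₁, S₂] : Fin 3 → Matrix (Fin 3) (Fin 3) ℝ) l)
        = M + (1 : ℝ) • (1 : Matrix (Fin 3) (Fin 3) ℝ) := by
      simp [Fin.sum_univ_three, hM]; abel
    rw [e] at h1; exact h1
  rw [NoNinefold.det_add_smul_one_fin_three] at hroot
  -- g(t) = (t - 1)·Q(t) with Q(1) = 3 + 2 tr M + e₂(M) < 0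
  have hQ1 : 1 + (M.trace + 1)
      + (M.trace + (M 0 0 * M 1 1 - M 0 1 * M 1 0 + (M 0 0 * M 2 2 - M 0 2 * M 2 0) + (M 1 1 * M 2 2 - M 1 2 * M 2 1)) + 1)
      < 0 := by
    have : (S₁ + S₂).trace = M.trace := by rw [hM]
    linarith
  obtain ⟨⟨tp, htp, hQp⟩, ⟨tm, htm, hQm⟩⟩ := quadratic_roots_around_one _ _ hQ1
  have hdet : ∀ t : ℝ, t ^ 2 + (M.trace + 1) * t
      + (M.trace + (M 0 0 * M 1 1 - M 0 1 * M 1 0 + (M 0 0 * M 2 2 - M 0 2 * M 2 0) + (M 1 1 * M 2 2 - M 1 2 * M 2 1)) + 1)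
        = 0 → (t • (1 : Matrix (Fin 3) (Fin 3) ℝ) + M).det = 0 := by
    intro t ht
    rw [add_comm, NoNinefold.det_add_smul_one_fin_three]
    have e : t ^ 3 + M.trace * t ^ 2
        + (M 0 0 * M 1 1 - M 0 1 * M 1 0 + (M 0 0 * M 2 2 - M 0 2 * M 2 0) + (M 1 1 * M 2 2 - M 1 2 * M 2 1)) * t + M.det
        = (t - 1) * (t ^ 2 + (M.trace + 1) * t
          + (M.trace + (M 0 0 * M 1 1 - M 0 1 * M 1 0 + (M 0 0 * M 2 2 - M 0 2 * M 2 0) + (M 1 1 * M 2 2 - M 1 2 * M 2 1)) + 1))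
          + (1 ^ 3 + M.trace * 1 ^ 2
            + (M 0 0 * M 1 1 - M 0 1 * M 1 0 + (M 0 0 * M 2 2 - M 0 2 * M 2 0) + (M 1 1 * M 2 2 - M 1 2 * M 2 1)) * 1 + M.det) := by
      ring
    rw [e, ht, hroot]; ring
  have h1M : (1 : Matrix (Fin 3) (Fin 3) ℝ) + S₁ + S₂ = 1 + M := by rw [hM, add_assoc]
  rw [h1M]
  constructor
  · obtain ⟨v, hv, hq⟩ := exists_quadForm_eq M (hdet tp hQp)
    refine ⟨v, ?_⟩
    rw [hq]
    exact mul_neg_of_neg_of_pos (by linarith) (hpos v hv)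
  · obtain ⟨w, hw, hq⟩ := exists_quadForm_eq M (hdet tm hQm)
    refine ⟨w, ?_⟩
    rw [hq]
    exact mul_pos (by linarith) (hpos w hw)


/-! ## 5. Any contact point `x₀ > 0` (scaling symmetry) and the semidefiniteness corollary -/

/-- Scaling symmetry `X ↦ x₀·X`: it turns the letters `S₁, S₂` into `x₀^{d₁}S₁, x₀^{d₂}S₂`. [folklore] -/
theorem det_pencil_comp_scale (d₁ d₂ : ℕ) (S₁ S₂ : Matrix (Fin 3) (Fin 3) ℝ) (x₀ : ℝ) :
    (∑ l, (X : ℝ[X]) ^ (![0, d₁, d₂] : Fin 3 → ℕ) l • ((![1, S₁, S₂] : Fin 3 → Matrix (Fin 3) (Fin 3) ℝ) l).map C).det.comp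
        (C x₀ * X)
      = (∑ l, (X : ℝ[X]) ^ (![0, d₁, d₂] : Fin 3 → ℕ) l •
          ((![1, x₀ ^ d₁ • S₁, x₀ ^ d₂ • S₂] : Fin 3 → Matrix (Fin 3) (Fin 3) ℝ) l).map C).det := by
  apply Polynomial.funext
  intro y
  rw [eval_comp, SymmetroidDescartes.eval_det_pencil, eval_mul, eval_C, eval_X, SymmetroidDescartes.eval_det_pencil]
  congr 1
  simp [Fin.sum_univ_three, mul_pow, smul_smul, mul_comm]

/-- A ninefold root at `x₀ ≠ 0` becomes a ninefold root at `1` after the scaling `X ↦ x₀·X`. [folklore] -/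
theorem dvd_comp_scale {p : ℝ[X]} {x₀ : ℝ} (h : (X - C x₀) ^ 9 ∣ p) :
    (X - C 1) ^ 9 ∣ p.comp (C x₀ * X) := by
  obtain ⟨r, hr⟩ := h
  refine ⟨C x₀ ^ 9 * r.comp (C x₀ * X), ?_⟩
  rw [hr, mul_comp, pow_comp, sub_comp, X_comp, C_comp]
  have e : C x₀ * X - C x₀ = C x₀ * (X - C (1 : ℝ)) := by rw [map_one]; ring
  rw [e]; ring

/-- **THE CONFLUENT NINE IS A PSEUDOLINE CONTACT — any contact point.**  Chambers II/IV, any real letters: if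
`det(1 + X^{d₁}S₁ + X^{d₂}S₂)` has a ninefold root at some `x₀ > 0`… in fact at any real `x₀`… then the quadratic
form of `F(x₀) = 1 + x₀^{d₁}S₁ + x₀^{d₂}S₂` takes both signs. [folklore] -/
theorem ninefold_root_indefinite (d₁ d₂ : ℕ) (S₁ S₂ : Matrix (Fin 3) (Fin 3) ℝ)
    (hch : (d₁ < d₂ ∧ 2 * d₂ < 3 * d₁) ∨ (2 * d₁ < d₂ ∧ d₂ < 3 * d₁)) (x₀ : ℝ)
    (h9 : (X - C x₀) ^ 9 ∣
      (∑ l, (X : ℝ[X]) ^ (![0, d₁, d₂] : Fin 3 → ℕ) l • ((![1, S₁, S₂] : Fin 3 → Matrix (Fin 3) (Fin 3) ℝ) l).map C).det) :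
    (∃ v : Fin 3 → ℝ, v ⬝ᵥ ((1 + x₀ ^ d₁ • S₁ + x₀ ^ d₂ • S₂).mulVec v) < 0)
      ∧ (∃ w : Fin 3 → ℝ, 0 < w ⬝ᵥ ((1 + x₀ ^ d₁ • S₁ + x₀ ^ d₂ • S₂).mulVec w)) := by
  have h := dvd_comp_scale h9
  rw [det_pencil_comp_scale] at h
  exact ninefold_root_indefinite_one d₁ d₂ (x₀ ^ d₁ • S₁) (x₀ ^ d₂ • S₂) hch h

/-- **Corollary (Claim L at the coalesced corner, chambers II/IV, all supports).**  A ninefold root of the determinant of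
a definite-bottom `(3,3)` row `1 + X^{d₁}S₁ + X^{d₂}S₂` in chamber II or IV is never a PSD-singular point: `F(x₀)` is not
positive semidefinite (and, by the symmetric statement, not negative semidefinite either). [folklore] -/
theorem not_posSemidef_of_ninefold_root (d₁ d₂ : ℕ) (S₁ S₂ : Matrix (Fin 3) (Fin 3) ℝ)
    (hch : (d₁ < d₂ ∧ 2 * d₂ < 3 * d₁) ∨ (2 * d₁ < d₂ ∧ d₂ < 3 * d₁)) (x₀ : ℝ)
    (h9 : (X - C x₀) ^ 9 ∣
      (∑ l, (X : ℝ[X]) ^ (![0, d₁, d₂] : Fin 3 → ℕ) l • ((![1, S₁, S₂] : Fin 3 → Matrix (Fin 3) (Fin 3) ℝ) l).map C).det) :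
    ¬ (1 + x₀ ^ d₁ • S₁ + x₀ ^ d₂ • S₂).PosSemidef ∧ ¬ (-(1 + x₀ ^ d₁ • S₁ + x₀ ^ d₂ • S₂)).PosSemidef := by
  obtain ⟨⟨v, hv⟩, ⟨w, hw⟩⟩ := ninefold_root_indefinite d₁ d₂ S₁ S₂ hch x₀ h9
  constructor
  · intro hP
    have := hP.dotProduct_mulVec_nonneg v
    simp only [star_trivial] at this
    linarith
  · intro hP
    have := hP.dotProduct_mulVec_nonneg w
    simp only [star_trivial, Matrix.neg_mulVec, dotProduct_neg] at this
    linarith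

end Summit.ValiantsHypothesis.ValiantsHypothesis.Theorems.LacunarySymmetroidMatrixDescartes.Census.ConfluentNine
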